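import Summits.CriticalPhenomena.Ising3DConformalLimit.Theorems.CoerciveSharpnessCoerciveReflectedGradientDefs
import HarnessLib

/-!
# Route `CoerciveSharpness`, crux `CoerciveReflectedGradient` (stmt-CriticalPhenomena-18197), line `base_box_rerun`:
# registered stub `stub_boxTorus`

`theorem stub_boxTorus : Sig.stub_boxTorus`, i.e. `Sig.stub_boxPointwise → BoxTorusIneq` (vocabulary in
`Theorems/CoerciveSharpnessCoerciveReflectedGradientDefs.lean`): the base-box pointwise inequality for one
current (stub A) integrated against the sourceless random current of the even torus `(ℤ/Lℤ)^d`, `L ≥ 4n+2`,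
gives
`1 ≤ Σ_δ ( Σ_{z ∈ Λ_m} ⟨σ_z̄ σ_{θ_δ z̄}⟩_{𝕋_L} + w Σ_{x,y ∈ Λ_n, y∼x} (⟨σ_0̄σ_x̄⟩ - ⟨σ_0̄σ_{θ_δ x̄}⟩)⟨σ_ȳσ_{θ_δ ȳ}⟩ )`.
This is the tree's `DCPNearCritical.torusIneq_of_lemma25_weight`
(`Literature/Probability/LatticeModels/SharpLengthDCPTorus.lean`, Duminil-Copin–Panis 2025 §2.2, eqs. (2.5)–(2.8),
(2.20)–(2.24)) with ONE changed step: Lemma 2.4 in current form (`IsFoldable.tsum_empty_connFix_le`,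
`Z^∅[z̄ ↔_{ℳ_δ} ℍ_δ] ≤ Z^{{z̄, θ_δ z̄}}`) is applied at EVERY base point `z̄`, `z ∈ Λ_m` — legitimate because
interior points (`m < n`) lie in the strict half `H_δ` of every direction (`proj_mem_dirHalf_of_mem_box`) —
instead of at `0̄` only; Lemma 2.5 (`DCPNearCritical.lemma25_torus`) and `Hle` (`DCPNearCritical.hle_torus`) are
the tree's discharged theorems. Helper file (`--supports stmt-CriticalPhenomena-18197`); no definition, no named
fact as hypothesis.
-/

noncomputable section

open Finset

namespace Summit.CriticalPhenomena.Ising3DConformalLimit.Cruxes.CoerciveReflectedGradient.BaseBoxRerun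

open scoped BigOperators ENNReal symmDiff
open Literature.Probability.LatticeModels
open Literature.Probability.LatticeModels.DCPLower
open Literature.Probability.LatticeModels.DCPNearCritical

variable {d : ℕ}

/-- **Interior box points lie in the strict half of every direction**: for `z ∈ Λ_m`, `m < n`,
`4n + 2 ≤ L` even, `z̄ ∈ H_δ` for all `2d` directions `δ` (the coordinate `z_{δ.1}` satisfies
`|z_{δ.1}| ≤ m < n`, so `z̄` is strictly on the box side of the hyperplane `x_{δ.1} = ±n`;
`Torus.proj_mem_leftSites_iff` / `proj_mem_rightSites_iff`). [folklore] -/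
theorem proj_mem_dirHalf_of_mem_box {L : ℕ} [NeZero L] (hL : Even L) {m n : ℕ} (hmn : m < n)
    (hnL : 4 * n + 2 ≤ L) {z : Site d} (hz : z ∈ box d m) (δ : Fin d × Bool) :
    Torus.proj L z ∈ dirHalf L n δ := by
  obtain ⟨i, b⟩ := δ
  have hzi := (mem_box.1 hz) i
  have hzn : z ∈ box d n := box_mono d hmn.le hz
  unfold dirHalf
  cases b
  · simp only [Bool.false_eq_true, if_false, sgn]
    rw [show ((-1 : ℤ) * n : ℤ) = ((-(n : ℤ) : ℤ)) by ring]
    rw [Torus.proj_mem_rightSites_iff hL i (m := n) (n := -(n : ℤ))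
      (by rw [abs_neg]; exact le_of_eq (abs_of_nonneg (by positivity))) hnL hzn]
    omega
  · simp only [if_true, sgn, one_mul]
    rw [Torus.proj_mem_leftSites_iff hL i (m := n) (n := (n : ℤ)) (le_of_eq (abs_of_nonneg (by positivity))) hnL hzn]
    omega

open Classical in
/-- **Registered stub `stub_boxTorus` of line `base_box_rerun`, proved** (`Sig.stub_boxPointwise → BoxTorusIneq`):
integrate the base-box pointwise inequality (stub A, hypothesis) against `𝐏^∅_{𝕋_L}`
("`c m^κ 𝐏^∅[Λ_m ⊆ 𝒮_n] ≤ 𝐄^∅[𝟙 φ(𝒮_n)]`", the base-box form of eq. (2.5) of Duminil-Copin–Panis 2025),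
bound the head `Σ_{z ∈ Λ_m} Σ_δ 𝐏^∅[z̄ ↔_{ℳ_δ} ℍ_δ]` by Lemma 2.4 in current form at the base points `z̄ ∈ H_δ`
(`IsFoldable.tsum_empty_connFix_le`, eq. (2.12)), the triple sum by Lemma 2.5 (`DCPNearCritical.lemma25_torus`)
with `Hle` (`DCPNearCritical.hle_torus`), and divide by `Z(∅)` (`isingTwoPoint_univ_eq_currentZ_div`). The proof
is the tree's `DCPNearCritical.torusIneq_of_lemma25_weight` with Step 2 summed over `z ∈ Λ_m`. -/
theorem stub_boxTorus : Sig.stub_boxTorus := by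
  unfold Sig.stub_boxTorus BoxTorusIneq
  intro hA d L _ hL m n hm hmn hnL β w hβ hw hφ
  classical
  -- notation
  set GT := torusGraph d L with hGT
  set E := edgesIn GT univ with hE
  have hn : 1 ≤ n := by omega
  have h2L : 2 < L := by omega
  set hD : ∀ δ : Fin d × Bool, IsFoldable GT (dirTheta L n δ) univ (dirHalf L n δ) :=
    fun δ => isFoldable_dir hL h2L n δ with hhD
  -- the connection predicates of a current and the random volumes
  set cT : (E → ℕ) → Fin d × Bool → Site d → Prop :=
    fun nc δ z => (hD δ).ConnFix ((hD δ).fold nc) (Torus.proj L z) with hcT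
  set Z : Finset (TorusSite d L) → ℝ≥0∞ := fun A => currentZ GT univ β E A with hZ
  set wt : (E → ℕ) → ℝ≥0∞ := fun nc => ind (csources GT univ nc = ∅ ∧ CSupp GT univ E nc) * cweight GT univ β nc with hwt
  set p0 := Torus.proj L (0 : Site d) with hp0
  -- face points are connected
  have hface : ∀ nc : E → ℕ, ∀ z ∈ box d n, ∀ i : Fin d,
      (z i = n → cT nc (i, true) z) ∧ (z i = -(n : ℤ) → cT nc (i, false) z) := by
    intro nc z hz i
    constructor
    · intro hzi
      refine ⟨Torus.proj L z, mem_univ _, dirTheta_proj_eq_self hL hnL hz (i, true) (by simpa [sgn] using hzi), ?_⟩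
      exact Relation.ReflTransGen.refl
    · intro hzi
      refine ⟨Torus.proj L z, mem_univ _, dirTheta_proj_eq_self hL hnL hz (i, false) (by simpa [sgn] using hzi), ?_⟩
      exact Relation.ReflTransGen.refl
  -- the pointwise inequality (stub A) for every current
  set A : (E → ℕ) → ℝ := fun nc => ∑ z ∈ box d m, ∑ δ : Fin d × Bool, if cT nc δ z then (1 : ℝ) else 0 with hAd
  set B : (E → ℕ) → ℝ := fun nc => ∑ δ : Fin d × Bool, ∑ x ∈ box d n, ∑ y ∈ box d n,
    (if (zdGraph d).Adj x y ∧ ¬ cT nc δ 0 ∧ ¬ cT nc δ x ∧ cT nc δ y then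
      isingTwoPoint GT (((box d n).filter fun z => ¬ cT nc δ z).image (Torus.proj L)) β 0 .free p0 (Torus.proj L x)
    else 0) with hB
  have hpt : ∀ nc, (1 : ℝ) ≤ A nc + w * B nc := fun nc =>
    hA d L m n hm hmn (by omega) β w hβ hw hφ (cT nc) (hface nc)
  have hA0 : ∀ nc, 0 ≤ A nc := fun nc =>
    sum_nonneg fun z _ => sum_nonneg fun δ _ => by split_ifs <;> norm_num
  have hB0 : ∀ nc, 0 ≤ B nc := fun nc =>
    sum_nonneg fun δ _ => sum_nonneg fun x hx => sum_nonneg fun y _ => ite_twoPoint_nonneg hβ (cT nc) δ hx y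
  -- Step 1: integrate the pointwise inequality against the sourceless current
  have hZdef : Z ∅ = ∑' nc, wt nc := rfl
  have step1 : Z ∅ ≤ ∑' nc, (wt nc * ENNReal.ofReal (A nc) + ENNReal.ofReal (w) * (wt nc * ENNReal.ofReal (B nc))) := by
    rw [hZdef]
    refine ENNReal.tsum_le_tsum fun nc => ?_
    have h1 : (1 : ℝ≥0∞) ≤ ENNReal.ofReal (A nc + w * B nc) := ENNReal.one_le_ofReal.2 (hpt nc)
    calc wt nc = wt nc * 1 := (mul_one _).symm
      _ ≤ wt nc * ENNReal.ofReal (A nc + w * B nc) := mul_le_mul_right h1 _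
      _ = wt nc * ENNReal.ofReal (A nc) + ENNReal.ofReal (w) * (wt nc * ENNReal.ofReal (B nc)) := by
          rw [ENNReal.ofReal_add (hA0 nc) (mul_nonneg hw (hB0 nc)), ENNReal.ofReal_mul hw]
          ring
  rw [ENNReal.tsum_add, ENNReal.tsum_mul_left] at step1
  -- Step 2: the head terms and Lemma 2.4 at every base point `z̄`, `z ∈ Λ_m`
  have hzH : ∀ z ∈ box d m, ∀ δ : Fin d × Bool, Torus.proj L z ∈ dirHalf L n δ := fun z hz δ =>
    proj_mem_dirHalf_of_mem_box hL hmn hnL hz δ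
  have step2 : ∑' nc, wt nc * ENNReal.ofReal (A nc) ≤
      ∑ z ∈ box d m, ∑ δ : Fin d × Bool, Z ({Torus.proj L z} ∆ {dirTheta L n δ (Torus.proj L z)}) := by
    have hre : ∀ nc, wt nc * ENNReal.ofReal (A nc) =
        ∑ z ∈ box d m, ∑ δ : Fin d × Bool, wt nc * ind (cT nc δ z) := by
      intro nc
      rw [hAd]
      simp only
      rw [ENNReal.ofReal_sum_of_nonneg (fun z _ => sum_nonneg fun δ _ => by split_ifs <;> norm_num),
        Finset.mul_sum]
      refine Finset.sum_congr rfl fun z _ => ?_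
      rw [ofReal_sum_ite_one, Finset.mul_sum]
    simp_rw [hre]
    rw [Summable.tsum_finsetSum (fun _ _ => ENNReal.summable)]
    refine Finset.sum_le_sum fun z hz => ?_
    rw [Summable.tsum_finsetSum (fun _ _ => ENNReal.summable)]
    refine Finset.sum_le_sum fun δ _ => ?_
    exact (hD δ).tsum_empty_connFix_le (hzH z hz δ) hβ
  -- Step 3: the triple sum and Lemma 2.5
  have H25 := lemma25_torus (d := d) hβ hn hL hnL
  have Hle : ∀ δ : Fin d × Bool, ∀ x ∈ box d n,
      Z ({p0} ∆ {dirTheta L n δ (Torus.proj L x)}) ≤ Z ({p0} ∆ {Torus.proj L x}) :=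
    fun δ x hx => hle_torus hL hn hnL hβ δ hx
  set R : Fin d × Bool → Site d → Site d → ℝ≥0∞ := fun δ x y =>
    if (zdGraph d).Adj x y then
      (Z ({p0} ∆ {Torus.proj L x}) - Z ({p0} ∆ {dirTheta L n δ (Torus.proj L x)})) *
        ENNReal.ofReal (isingTwoPoint GT univ β 0 .free (Torus.proj L y) (dirTheta L n δ (Torus.proj L y)))
    else 0 with hR
  have step3 : ∑' nc, wt nc * ENNReal.ofReal (B nc) ≤
      ∑ δ : Fin d × Bool, ∑ x ∈ box d n, ∑ y ∈ box d n, R δ x y := by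
    have hre : ∀ nc, wt nc * ENNReal.ofReal (B nc) = ∑ δ : Fin d × Bool, ∑ x ∈ box d n, ∑ y ∈ box d n,
        wt nc * (ind ((zdGraph d).Adj x y ∧ ¬ cT nc δ 0 ∧ ¬ cT nc δ x ∧ cT nc δ y) *
          ENNReal.ofReal (isingTwoPoint GT (((box d n).filter fun z => ¬ cT nc δ z).image (Torus.proj L)) β 0 .free
            p0 (Torus.proj L x))) := by
      intro nc
      rw [hB]
      simp only
      rw [ENNReal.ofReal_sum_of_nonneg (fun δ _ => sum_nonneg fun x hx => sum_nonneg fun y _ =>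
        ite_twoPoint_nonneg hβ (cT nc) δ hx y), Finset.mul_sum]
      refine Finset.sum_congr rfl fun δ _ => ?_
      rw [ENNReal.ofReal_sum_of_nonneg (fun x hx => sum_nonneg fun y _ => ite_twoPoint_nonneg hβ (cT nc) δ hx y),
        Finset.mul_sum]
      refine Finset.sum_congr rfl fun x hx => ?_
      rw [ENNReal.ofReal_sum_of_nonneg (fun y _ => ite_twoPoint_nonneg hβ (cT nc) δ hx y), Finset.mul_sum]
      refine Finset.sum_congr rfl fun y _ => ?_
      rw [ofReal_ite_eq_ind_mul]
    simp_rw [hre]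
    rw [Summable.tsum_finsetSum (fun _ _ => ENNReal.summable)]
    refine Finset.sum_le_sum fun δ _ => ?_
    rw [Summable.tsum_finsetSum (fun _ _ => ENNReal.summable)]
    refine Finset.sum_le_sum fun x hx => ?_
    rw [Summable.tsum_finsetSum (fun _ _ => ENNReal.summable)]
    refine Finset.sum_le_sum fun y hy => ?_
    by_cases hxy : (zdGraph d).Adj x y
    · rw [hR]
      simp only [if_pos hxy]
      have h25 := H25 δ x hx y hy hxy
      refine le_trans (le_of_eq (tsum_congr fun nc => ?_)) h25
      rw [ind_congr (show ((zdGraph d).Adj x y ∧ ¬ cT nc δ 0 ∧ ¬ cT nc δ x ∧ cT nc δ y) ↔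
        (¬ cT nc δ 0 ∧ ¬ cT nc δ x ∧ cT nc δ y) from ⟨fun h => h.2, fun h => ⟨hxy, h⟩⟩)]
    · rw [hR]
      simp only [if_neg hxy]
      refine le_of_eq (ENNReal.tsum_eq_zero.2 fun nc => ?_)
      rw [ind_of_false (fun h => hxy h.1), zero_mul, mul_zero]
  -- Step 4: the inequality in `ℝ≥0∞`
  have step4 : Z ∅ ≤ ∑ z ∈ box d m, ∑ δ : Fin d × Bool, Z ({Torus.proj L z} ∆ {dirTheta L n δ (Torus.proj L z)}) +
      ENNReal.ofReal (w) * ∑ δ : Fin d × Bool, ∑ x ∈ box d n, ∑ y ∈ box d n, R δ x y :=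
    step1.trans (add_le_add step2 (mul_le_mul_right step3 _))
  -- Step 5: to real numbers
  have hfin : ∀ A', Z A' ≠ ∞ := fun A' => currentZ_univ_ne_top GT hβ A'
  have hZ1 : 1 ≤ Z ∅ := one_le_currentZ_univ_empty GT β
  set z0 : ℝ := (Z ∅).toReal with hz0def
  have hz0 : 0 < z0 := ENNReal.toReal_pos (ne_of_gt (lt_of_lt_of_le zero_lt_one hZ1)) (hfin ∅)
  have hdict : ∀ a b, isingTwoPoint GT univ β 0 .free a b = (Z ({a} ∆ {b})).toReal / z0 := fun a b =>
    isingTwoPoint_univ_eq_currentZ_div GT hβ a b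
  have hdict' : ∀ a b, (Z ({a} ∆ {b})).toReal = z0 * isingTwoPoint GT univ β 0 .free a b := fun a b => by
    rw [hdict, mul_div_cancel₀ _ hz0.ne']
  have hRfin : ∀ δ x y, R δ x y ≠ ∞ := by
    intro δ x y
    rw [hR]
    simp only
    split_ifs
    · exact ENNReal.mul_ne_top (ENNReal.sub_ne_top (hfin _)) ENNReal.ofReal_ne_top
    · exact ENNReal.zero_ne_top
  have hRreal : ∀ δ, ∀ x ∈ box d n, ∀ y, (R δ x y).toReal =
      if (zdGraph d).Adj x y then
        ((Z ({p0} ∆ {Torus.proj L x})).toReal - (Z ({p0} ∆ {dirTheta L n δ (Torus.proj L x)})).toReal) *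
          isingTwoPoint GT univ β 0 .free (Torus.proj L y) (dirTheta L n δ (Torus.proj L y))
      else 0 := by
    intro δ x hx y
    rw [hR]
    simp only
    split_ifs with hxy
    · rw [ENNReal.toReal_mul, ENNReal.toReal_sub_of_le (Hle δ x hx) (hfin _),
        ENNReal.toReal_ofReal (isingTwoPoint_free_nonneg_of_mem _ hβ (mem_univ _) (mem_univ _))]
    · rfl
  have hsumfin : ∀ δ : Fin d × Bool, ∑ x ∈ box d n, ∑ y ∈ box d n, R δ x y ≠ ∞ := fun δ =>
    ENNReal.sum_ne_top.2 fun x _ => ENNReal.sum_ne_top.2 fun y _ => hRfin δ x y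
  have hheadfin : ∑ z ∈ box d m, ∑ δ : Fin d × Bool, Z ({Torus.proj L z} ∆ {dirTheta L n δ (Torus.proj L z)}) ≠ ∞ :=
    ENNReal.sum_ne_top.2 fun z _ => ENNReal.sum_ne_top.2 fun δ _ => hfin _
  have hRHSfin : ∑ z ∈ box d m, ∑ δ : Fin d × Bool, Z ({Torus.proj L z} ∆ {dirTheta L n δ (Torus.proj L z)}) +
      ENNReal.ofReal (w) * ∑ δ : Fin d × Bool, ∑ x ∈ box d n, ∑ y ∈ box d n, R δ x y ≠ ∞ :=
    ENNReal.add_ne_top.2 ⟨hheadfin,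
      ENNReal.mul_ne_top ENNReal.ofReal_ne_top (ENNReal.sum_ne_top.2 fun δ _ => hsumfin δ)⟩
  have step5 : z0 ≤ ∑ z ∈ box d m, ∑ δ : Fin d × Bool, (Z ({Torus.proj L z} ∆ {dirTheta L n δ (Torus.proj L z)})).toReal +
      w * ∑ δ : Fin d × Bool, ∑ x ∈ box d n, ∑ y ∈ box d n, (R δ x y).toReal := by
    have h := ENNReal.toReal_mono hRHSfin step4
    rw [ENNReal.toReal_add hheadfin
        (ENNReal.mul_ne_top ENNReal.ofReal_ne_top (ENNReal.sum_ne_top.2 fun δ _ => hsumfin δ)),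
      ENNReal.toReal_sum (fun z _ => ENNReal.sum_ne_top.2 fun δ _ => hfin _), ENNReal.toReal_mul,
      ENNReal.toReal_ofReal hw, ENNReal.toReal_sum (fun δ _ => hsumfin δ)] at h
    refine h.trans (le_of_eq ?_)
    congr 1
    · refine Finset.sum_congr rfl fun z _ => ?_
      exact ENNReal.toReal_sum (fun δ _ => hfin _)
    · congr 1
      refine Finset.sum_congr rfl fun δ _ => ?_
      rw [ENNReal.toReal_sum (fun x _ => ENNReal.sum_ne_top.2 fun y _ => hRfin δ x y)]
      refine Finset.sum_congr rfl fun x _ => ?_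
      exact ENNReal.toReal_sum (fun y _ => hRfin δ x y)
  -- Step 6: divide by `Z(∅)` and identify the two-point functions
  have hθ : ∀ (δ : Fin d × Bool) (z : Site d), dirTheta L n δ (Torus.proj L z) = Torus.proj L (dirRefl δ n z) :=
    fun δ z => dirTheta_proj n δ z
  have h1 : ∀ (z : Site d) (δ : Fin d × Bool), (Z ({Torus.proj L z} ∆ {dirTheta L n δ (Torus.proj L z)})).toReal =
      z0 * isingTwoPoint GT univ β 0 .free (Torus.proj L z) (Torus.proj L (dirRefl δ n z)) := fun z δ => by
    rw [hθ δ z, hdict']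
  have h2 : ∀ δ : Fin d × Bool, ∑ x ∈ box d n, ∑ y ∈ box d n, (R δ x y).toReal =
      z0 * ∑ x ∈ box d n, ∑ y ∈ box d n,
        (if (zdGraph d).Adj x y then
          (isingTwoPoint GT univ β 0 .free p0 (Torus.proj L x) -
              isingTwoPoint GT univ β 0 .free p0 (Torus.proj L (dirRefl δ n x))) *
            isingTwoPoint GT univ β 0 .free (Torus.proj L y) (Torus.proj L (dirRefl δ n y))
        else 0) := by
    intro δ
    rw [Finset.mul_sum]
    refine Finset.sum_congr rfl fun x hx => ?_
    rw [Finset.mul_sum]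
    refine Finset.sum_congr rfl fun y _ => ?_
    rw [hRreal δ x hx y]
    split_ifs with hxy
    · rw [hdict' p0 (Torus.proj L x), hθ δ x, hdict', hθ δ y]
      ring
    · rw [mul_zero]
  simp only [h1, h2] at step5
  have hsum1 : ∑ z ∈ box d m, ∑ δ : Fin d × Bool,
      z0 * isingTwoPoint GT univ β 0 .free (Torus.proj L z) (Torus.proj L (dirRefl δ n z)) =
      z0 * ∑ δ : Fin d × Bool, ∑ z ∈ box d m,
        isingTwoPoint GT univ β 0 .free (Torus.proj L z) (Torus.proj L (dirRefl δ n z)) := by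
    rw [Finset.sum_comm, Finset.mul_sum]
    refine Finset.sum_congr rfl fun δ _ => ?_
    rw [Finset.mul_sum]
  have hsum2 : w * ∑ δ : Fin d × Bool, z0 * ∑ x ∈ box d n, ∑ y ∈ box d n,
        (if (zdGraph d).Adj x y then
          (isingTwoPoint GT univ β 0 .free p0 (Torus.proj L x) -
              isingTwoPoint GT univ β 0 .free p0 (Torus.proj L (dirRefl δ n x))) *
            isingTwoPoint GT univ β 0 .free (Torus.proj L y) (Torus.proj L (dirRefl δ n y))
        else 0) =
      z0 * (w * ∑ δ : Fin d × Bool, ∑ x ∈ box d n, ∑ y ∈ box d n,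
        (if (zdGraph d).Adj x y then
          (isingTwoPoint GT univ β 0 .free p0 (Torus.proj L x) -
              isingTwoPoint GT univ β 0 .free p0 (Torus.proj L (dirRefl δ n x))) *
            isingTwoPoint GT univ β 0 .free (Torus.proj L y) (Torus.proj L (dirRefl δ n y))
        else 0)) := by
    rw [← Finset.mul_sum]
    ring
  rw [hsum1, hsum2, ← mul_add] at step5
  have hfinal : (1 : ℝ) ≤ (∑ δ : Fin d × Bool, ∑ z ∈ box d m,
        isingTwoPoint GT univ β 0 .free (Torus.proj L z) (Torus.proj L (dirRefl δ n z))) +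
      w * ∑ δ : Fin d × Bool, ∑ x ∈ box d n, ∑ y ∈ box d n,
        (if (zdGraph d).Adj x y then
          (isingTwoPoint GT univ β 0 .free p0 (Torus.proj L x) -
              isingTwoPoint GT univ β 0 .free p0 (Torus.proj L (dirRefl δ n x))) *
            isingTwoPoint GT univ β 0 .free (Torus.proj L y) (Torus.proj L (dirRefl δ n y))
        else 0) := by
    nth_rewrite 1 [← mul_one z0] at step5
    exact le_of_mul_le_mul_left step5 hz0
  rw [Finset.mul_sum, ← Finset.sum_add_distrib] at hfinal
  exact hfinal

end Summit.CriticalPhenomena.Ising3DConformalLimit.Cruxes.CoerciveReflectedGradient.BaseBoxRerun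

end
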